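import Literature.NumberTheory.Automorphic.PicardCMUniverse
import Mathlib.NumberTheory.NumberField.CMField
import HarnessLib

/-!
# Degree bookkeeping for the corner product `P = A₀ × A₁ × A₂ × A₃` (row M22 / Fg7 glue)

Cell `pub-hodgecm2` (COR-CM), seat `model-1`.  Pure arithmetic of dimensions in the Picard–CM model universe
(`Literature.NumberTheory.Automorphic.PicardCM.Var`): a CM field has even degree `≥ 2`, so a coded CM abelian
variety `.cm c` has `Var.dim (.cm c) = [E_c:ℚ]/2 ≥ 1`, the corner product of four of them has dimension `≥ 4`,
and the degree identity `2 * (dim P - 2) + 4 = 2 * dim P` used to type the Fourier-type operator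
`D : H^{2(dim P - 2)}(P) → H⁴(P)` of `Fact_algDuality` (`Model.fourierSum … 4 h`) holds.
-/

namespace Summit.HodgeConjecture.CorCM.Model

open Literature.NumberTheory.Automorphic.PicardCM NumberField

/-- A CM field has degree at least `2` over `ℚ` (it is totally complex: `[K:ℚ] = 2 · #(complex places)`,
and `[K:ℚ] ≥ 1`). [cite: Shimura1998, §5.5] -/
theorem two_le_finrank_of_isCMField (K : Type*) [Field K] [NumberField K] [IsCMField K] :
    2 ≤ Module.finrank ℚ K := by
  have h := IsTotallyComplex.finrank K
  have hpos : 0 < Module.finrank ℚ K := Module.finrank_pos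
  omega

/-- A coded CM abelian variety has dimension `Var.dim (.cm c) = [E_c:ℚ]/2 ≥ 1`. [folklore] -/
theorem one_le_dim_cm (c : CMCode) : 1 ≤ Var.dim (.cm c) := by
  rw [Var.dim_cm]
  have h := two_le_finrank_of_isCMField c.E
  omega

/-- The corner product `P = A_{c₀} × A_{c₁} × A_{c₂} × A_{c₃}` of four coded CM abelian varieties has
dimension `≥ 4`. [folklore] -/
theorem four_le_dim_prod4 (c : Fin 4 → CMCode) :
    4 ≤ Var.dim (Var.prod (Var.prod (Var.prod (.cm (c 0)) (.cm (c 1))) (.cm (c 2))) (.cm (c 3))) := by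
  simp only [Var.dim_prod]
  have h0 := one_le_dim_cm (c 0)
  have h1 := one_le_dim_cm (c 1)
  have h2 := one_le_dim_cm (c 2)
  have h3 := one_le_dim_cm (c 3)
  omega

/-- The degree identity `2 * (dim P - 2) + 4 = 2 * dim P` for the corner product (types the Fourier-type
operator `H^{2(dim P - 2)}(P) → H⁴(P)` of row M22 against the light trace in degree `2 dim P`). [folklore] -/
theorem two_mul_dim_prod4_sub_two_add_four (c : Fin 4 → CMCode) :
    2 * (Var.dim (Var.prod (Var.prod (Var.prod (.cm (c 0)) (.cm (c 1))) (.cm (c 2))) (.cm (c 3))) - 2) + 4 =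
      2 * Var.dim (Var.prod (Var.prod (Var.prod (.cm (c 0)) (.cm (c 1))) (.cm (c 2))) (.cm (c 3))) := by
  have h := four_le_dim_prod4 c
  omega

/-- The complementary-codimension identity `(dim P - 2) + 2 = dim P` for the corner product (the shape
`p + j = n` of the K-c transport `fourierSum_mem_ratAlgebraicClasses`). [folklore] -/
theorem dim_prod4_sub_two_add_two (c : Fin 4 → CMCode) :
    Var.dim (Var.prod (Var.prod (Var.prod (.cm (c 0)) (.cm (c 1))) (.cm (c 2))) (.cm (c 3))) - 2 + 2 =
      Var.dim (Var.prod (Var.prod (Var.prod (.cm (c 0)) (.cm (c 1))) (.cm (c 2))) (.cm (c 3))) := by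
  have h := four_le_dim_prod4 c
  omega

end Summit.HodgeConjecture.CorCM.Model
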